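import Summits.NavierStokesRegularity.NavierStokesRegularity.Theorems.EulerZoomLiouvillePowerGaugeEulerLiouvilleWeakBernoulliTransport

/-!
# The similarity-Bernoulli transport law IN THE WEAK CLASS, III: member level and the one-sided form
# (crux `EulerZoomLiouville.PowerGaugeEulerLiouville` = stmt-NavierStokesRegularity-19832, line `birth`)

Width seat `ns-ezl-w1` (g6) under the crux LEAD, cell ns-regularity-ideate.  TOOL for the genuinely weak
exactly-self-similar stratum (open stub `stub_selfSimilarWeakRest`).

For a `C²` self-similar Euler profile `(V, P)` with exponent `γ` (Constantin–Ignatova–Vicol (3.3)), the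
similarity field `W = γy + V` (`selfSimilarTransport γ 0 V`) and the self-similar Bernoulli function
`ℋ = ½|W|² + P + ½γ(γ−1)|y|²` (`selfSimilarBernoulli γ 0 V P`) satisfy the transport identity (3.31)
`W·∇ℋ = (2γ−1)|W|²`, equivalently — with `div W = 3γ` — `div(ℋW) = 3γℋ − (1−2γ)|W|²`.  Every
Bernoulli-high-set argument of the lineage (piercing, channels, squeeze, «jets must turn») starts here, and
so far it was available only for classical profiles (Lagrangian `…SimilarityBernoulli`, pointwise
`IsSelfSimilarEulerProfile.fderiv_selfSimilarBernoulli_transport`).  This chain of three files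
(`…WeakBernoulliTransportTools` / `…WeakBernoulliTransport` / `…WeakBernoulliTransportMember`) proves it in
the sense of distributions for profiles WITHOUT ANY REGULARITY, from exactly the three weak identities the
lineage has transferred to the profile of a weak class member (`Past.profileData_of_past`): for every test
function `θ`,

  `∫ ℋ ⟪W, ∇θ⟫ = −3γ ∫ θ ℋ + (1 − 2γ) ∫ θ |W|²`,

given (E) the profile local energy EQUALITY, (M) the weak profile equation tested with the vector field
`ψ = θ·y`, and (W) weak incompressibility in the form `∫⟪W, ∇φ⟫ = −3γ∫φ` tested with `φ = θ|y|²`, for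
`V ∈ L⁶_loc`, `P ∈ L^{3/2}_loc` (the class data); pointwise the target integrand is
`−½·(E) + γ·(M) + ½γ(2γ−1)·(W)`.

THIS FILE: `WeakBernoulli.weak_transport_ineq` (one-sided form, `γ ≤ ½`, `θ ≥ 0`:
`0 ≤ ∫ ℋ⟪W,∇θ⟫ + 3γ∫θℋ` — `ℋ` is a weak super-solution of the similarity transport, i.e. non-decreasing
along backward similarity orbits in `𝒟′`); **`WeakBernoulli.weak_transport_law_of_past`** (crux hypotheses
verbatim, `0 < ρ ≤ ½`, exactly self-similar about `(T, x₀)` on a past sub-slab ⇒ the law for `(V, P)` with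
`γ = 1/(2+ρ)`); **`WeakBernoulli.weak_transport_law_of_selfSimilar`** (origin-centred, the binder shape of the
skeleton's `IsExactlySelfSimilar`); `WeakBernoulli.weak_transport_ineq_of_selfSimilar`.  NO `C²` hypothesis.

WHAT THIS IS NOT: not NS, not E, not the stub — a weak-class TOOL (`--supports` stmt-19832).
[folklore; cf. ConstantinIgnatovaVicol2026Putative §3.4.3 (3.31)]
-/

noncomputable section

set_option linter.dupNamespace false

open MeasureTheory Set Filter Topology Metric Function TopologicalSpace
open scoped ENNReal NNReal RealInnerProductSpace ContDiff

namespace Summit.NavierStokesRegularity.NavierStokesRegularity.Theorems.PowerGaugeEulerLiouville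

open Literature.Analysis Literature.Analysis.FunctionSpaces Literature.Analysis.FluidPDE

namespace WeakBernoulli

/-! ## The one-sided form (profile level) -/

section Law

variable {V : EuclideanSpace ℝ (Fin 3) → EuclideanSpace ℝ (Fin 3)} {P : EuclideanSpace ℝ (Fin 3) → ℝ}

/-- **One-sided form (`γ ≤ ½`): `ℋ` is a weak super-solution of the similarity transport.**  Under the
hypotheses of `weak_transport_law` with `γ ≤ ½`, for every NONNEGATIVE test function `θ`:
`0 ≤ ∫ ℋ ⟪W, ∇θ⟫ + 3γ ∫ θ ℋ` (`= (1−2γ)∫θ|W|² ≥ 0`) — the distributional form of «`ℋ` is non-increasing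
along forward similarity orbits / non-decreasing backward» (CIV (3.31)), with no flow and no regularity. [folklore] -/
theorem weak_transport_ineq {γ : ℝ} (hγ : γ ≤ 1 / 2) (hVm : AEStronglyMeasurable V volume)
    (hPm : AEStronglyMeasurable P volume)
    (hV6 : ∀ r : ℝ, MemLp V 6 (volume.restrict (ball (0 : EuclideanSpace ℝ (Fin 3)) r)))
    (hP : ∀ r : ℝ, MemLp P (3 / 2 : ℝ≥0∞) (volume.restrict (ball (0 : EuclideanSpace ℝ (Fin 3)) r)))
    (hdiv : IsWeaklyDivFree V)
    (heq : ∀ ψ : EuclideanSpace ℝ (Fin 3) → EuclideanSpace ℝ (Fin 3),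
      IsTestFunctionOn (⊤ : Opens (EuclideanSpace ℝ (Fin 3))) ψ →
        ∫ x, (⟪V x, fderiv ℝ ψ x (V x)⟫ + P x * VectorCalculus.divergence ψ x +
          γ * ⟪V x, fderiv ℝ ψ x x⟫ + (4 * γ - 1) * ⟪V x, ψ x⟫) = 0)
    (hen : ∀ σ : EuclideanSpace ℝ (Fin 3) → ℝ, IsTestFunctionOn (⊤ : Opens (EuclideanSpace ℝ (Fin 3))) σ →
      (2 - 5 * γ) * ∫ x, σ x * ‖V x‖ ^ 2 =
        (∫ x, (‖V x‖ ^ 2 + 2 * P x) * ⟪V x, gradient σ x⟫) + γ * ∫ x, ‖V x‖ ^ 2 * ⟪x, gradient σ x⟫)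
    {θ : EuclideanSpace ℝ (Fin 3) → ℝ} (hθ : IsTestFunctionOn (⊤ : Opens (EuclideanSpace ℝ (Fin 3))) θ)
    (hθ0 : ∀ y, 0 ≤ θ y) :
    0 ≤ (∫ y, selfSimilarBernoulli γ 0 V P y * ⟪selfSimilarTransport γ 0 V y, gradient θ y⟫) +
      3 * γ * ∫ y, θ y * selfSimilarBernoulli γ 0 V P y := by
  rw [weak_transport_law hVm hPm hV6 hP hdiv heq hen hθ]
  have h : 0 ≤ ∫ y, θ y * ‖selfSimilarTransport γ 0 V y‖ ^ 2 :=
    integral_nonneg fun y => mul_nonneg (hθ0 y) (by positivity)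
  nlinarith

end Law

/-! ## Member level: crux hypotheses verbatim + exact self-similarity (past sub-slab / origin) -/

section Member

/-- **THE WEAK BERNOULLI TRANSPORT LAW OF A PAST-EXACT SELF-SIMILAR CLASS MEMBER** (`0 < ρ ≤ ½`, `γ = 1/(2+ρ)`;
NO regularity of the profile).  Let `(u, p)` be a suitable weak Euler pair on the slab `(−∞,0) × ℝ³` with weak
spatial gradient `H` and the three power gauges at the origin (the crux's hypotheses verbatim), exactly
self-similar about `(T, x₀)` with profile `(V, P)` for `τ < T₁` (`T₁ ≤ 0`, `T₁ ≤ T`).  Then for every test function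
`θ`: `∫ ℋ ⟪W, ∇θ⟫ = −3γ ∫ θ ℋ + (1 − 2γ) ∫ θ |W|²` with `W = selfSimilarTransport γ 0 V`,
`ℋ = selfSimilarBernoulli γ 0 V P` — CIV (3.31) for the genuinely weak self-similar members of Seregin's class
(`…SelfSimilarPastProfileEquations.profileData_of_past` + `weak_transport_law`). [folklore] -/
theorem weak_transport_law_of_past {ρ : ℝ} (hρ : 0 < ρ) (hρh : ρ ≤ 1 / 2)
    {T T₁ : ℝ} (hT₁ : T₁ ≤ 0) (hTT₁ : T₁ ≤ T) (x₀ : EuclideanSpace ℝ (Fin 3))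
    {u : ℝ → EuclideanSpace ℝ (Fin 3) → EuclideanSpace ℝ (Fin 3)} {p : ℝ → EuclideanSpace ℝ (Fin 3) → ℝ}
    {H : ℝ → EuclideanSpace ℝ (Fin 3) → EuclideanSpace ℝ (Fin 3) →L[ℝ] EuclideanSpace ℝ (Fin 3)} {c : ℝ≥0}
    (hsw : IsSuitableWeakSolutionOn (slab (EuclideanSpace ℝ (Fin 3)) (Iio 0) isOpen_Iio) 0 0 u p)
    (hH : HasWeakSpatialGradientOn (slab (EuclideanSpace ℝ (Fin 3)) (Iio 0) isOpen_Iio) u H)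
    (hgauge : ∀ a : ℝ, 0 < a →
      ENNReal.ofReal (a ^ (2 * ρ)) * cknA a (0 : ℝ × EuclideanSpace ℝ (Fin 3)) u +
          ENNReal.ofReal (a ^ ρ) * cknE a (0 : ℝ × EuclideanSpace ℝ (Fin 3)) H +
        ENNReal.ofReal (a ^ (2 * ρ)) * cknD a (0 : ℝ × EuclideanSpace ℝ (Fin 3)) p ≤ (c : ℝ≥0∞))
    {V : EuclideanSpace ℝ (Fin 3) → EuclideanSpace ℝ (Fin 3)} {P : EuclideanSpace ℝ (Fin 3) → ℝ}
    (hu : ∀ τ : ℝ, τ < T₁ → u τ = fun x => selfSimilarCollapse (1 / (2 + ρ)) T V τ (x - x₀))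
    (hp : ∀ τ : ℝ, τ < T₁ → p τ = fun x => selfSimilarCollapsePressure (1 / (2 + ρ)) T P τ (x - x₀))
    {θ : EuclideanSpace ℝ (Fin 3) → ℝ} (hθ : IsTestFunctionOn (⊤ : Opens (EuclideanSpace ℝ (Fin 3))) θ) :
    ∫ y, selfSimilarBernoulli (1 / (2 + ρ)) 0 V P y * ⟪selfSimilarTransport (1 / (2 + ρ)) 0 V y, gradient θ y⟫ =
      -(3 * (1 / (2 + ρ))) * (∫ y, θ y * selfSimilarBernoulli (1 / (2 + ρ)) 0 V P y) +
        (1 - 2 * (1 / (2 + ρ))) * ∫ y, θ y * ‖selfSimilarTransport (1 / (2 + ρ)) 0 V y‖ ^ 2 := by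
  have hA : ∀ a : ℝ, 0 < a → ENNReal.ofReal (a ^ (2 * ρ)) *
      cknA a (0 : ℝ × EuclideanSpace ℝ (Fin 3)) u ≤ (c : ℝ≥0∞) :=
    fun a ha => le_trans (le_trans le_self_add le_self_add) (hgauge a ha)
  have hE : ∀ a : ℝ, 0 < a → ENNReal.ofReal (a ^ ρ) *
      cknE a (0 : ℝ × EuclideanSpace ℝ (Fin 3)) H ≤ (c : ℝ≥0∞) :=
    fun a ha => le_trans (le_trans le_add_self le_self_add) (hgauge a ha)
  have hD : ∀ a : ℝ, 0 < a → ENNReal.ofReal (a ^ (2 * ρ)) *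
      cknD a (0 : ℝ × EuclideanSpace ℝ (Fin 3)) p ≤ (c : ℝ≥0∞) :=
    fun a ha => le_trans le_add_self (hgauge a ha)
  obtain ⟨G, hVm, hPm, -, -, -, -, -, -, hV6, -, hP32, hdiv, heq, -, hen⟩ :=
    Past.profileData_of_past hρ hρh hT₁ hTT₁ x₀ hsw.distributional hH hA hE hD hu hp
  exact weak_transport_law hVm hPm hV6 hP32 hdiv heq hen hθ

/-- **THE WEAK BERNOULLI TRANSPORT LAW OF AN EXACTLY SELF-SIMILAR CLASS MEMBER (origin-centred; the binder
shape of the skeleton's `IsExactlySelfSimilar`).**  Crux hypotheses verbatim, `0 < ρ ≤ ½`,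
`u(τ) = selfSimilarCollapse γ 0 V τ`, `p(τ) = selfSimilarCollapsePressure γ 0 P τ` for `τ < 0`, `γ = 1/(2+ρ)`:
for every test function `θ`, `∫ ℋ ⟪W, ∇θ⟫ = −3γ ∫ θ ℋ + (1 − 2γ) ∫ θ |W|²` — the similarity-Bernoulli function
of a WEAK class profile is a distributional solution of `div(ℋW) = 3γℋ − (1−2γ)|W|²` (CIV (3.31)), no `C²`
hypothesis. [folklore] -/
theorem weak_transport_law_of_selfSimilar {ρ : ℝ} (hρ : 0 < ρ) (hρh : ρ ≤ 1 / 2)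
    {u : ℝ → EuclideanSpace ℝ (Fin 3) → EuclideanSpace ℝ (Fin 3)} {p : ℝ → EuclideanSpace ℝ (Fin 3) → ℝ}
    {H : ℝ → EuclideanSpace ℝ (Fin 3) → EuclideanSpace ℝ (Fin 3) →L[ℝ] EuclideanSpace ℝ (Fin 3)} {c : ℝ≥0}
    (hsw : IsSuitableWeakSolutionOn (slab (EuclideanSpace ℝ (Fin 3)) (Iio 0) isOpen_Iio) 0 0 u p)
    (hH : HasWeakSpatialGradientOn (slab (EuclideanSpace ℝ (Fin 3)) (Iio 0) isOpen_Iio) u H)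
    (hgauge : ∀ a : ℝ, 0 < a →
      ENNReal.ofReal (a ^ (2 * ρ)) * cknA a (0 : ℝ × EuclideanSpace ℝ (Fin 3)) u +
          ENNReal.ofReal (a ^ ρ) * cknE a (0 : ℝ × EuclideanSpace ℝ (Fin 3)) H +
        ENNReal.ofReal (a ^ (2 * ρ)) * cknD a (0 : ℝ × EuclideanSpace ℝ (Fin 3)) p ≤ (c : ℝ≥0∞))
    {V : EuclideanSpace ℝ (Fin 3) → EuclideanSpace ℝ (Fin 3)} {P : EuclideanSpace ℝ (Fin 3) → ℝ}
    (hu : ∀ τ : ℝ, τ < 0 → u τ = selfSimilarCollapse (1 / (2 + ρ)) 0 V τ)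
    (hp : ∀ τ : ℝ, τ < 0 → p τ = selfSimilarCollapsePressure (1 / (2 + ρ)) 0 P τ)
    {θ : EuclideanSpace ℝ (Fin 3) → ℝ} (hθ : IsTestFunctionOn (⊤ : Opens (EuclideanSpace ℝ (Fin 3))) θ) :
    ∫ y, selfSimilarBernoulli (1 / (2 + ρ)) 0 V P y * ⟪selfSimilarTransport (1 / (2 + ρ)) 0 V y, gradient θ y⟫ =
      -(3 * (1 / (2 + ρ))) * (∫ y, θ y * selfSimilarBernoulli (1 / (2 + ρ)) 0 V P y) +
        (1 - 2 * (1 / (2 + ρ))) * ∫ y, θ y * ‖selfSimilarTransport (1 / (2 + ρ)) 0 V y‖ ^ 2 := by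
  have hu' : ∀ τ : ℝ, τ < 0 → u τ = fun x => selfSimilarCollapse (1 / (2 + ρ)) 0 V τ (x - 0) :=
    fun τ hτ => by rw [hu τ hτ]; funext x; rw [sub_zero]
  have hp' : ∀ τ : ℝ, τ < 0 → p τ = fun x => selfSimilarCollapsePressure (1 / (2 + ρ)) 0 P τ (x - 0) :=
    fun τ hτ => by rw [hp τ hτ]; funext x; rw [sub_zero]
  exact weak_transport_law_of_past hρ hρh le_rfl le_rfl 0 hsw hH hgauge hu' hp' hθ

/-- **One-sided member form**: for an exactly self-similar class member (`0 < ρ ≤ ½`, so `γ = 1/(2+ρ) < ½`) and every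
NONNEGATIVE test function `θ`: `0 ≤ ∫ ℋ ⟪W, ∇θ⟫ + 3γ ∫ θ ℋ` — the weak profile's Bernoulli function is
non-decreasing along backward similarity orbits in the distributional sense (the monotonicity every needle
portrait of the `C²` stratum starts from, now in the weak stratum of `stub_selfSimilarWeakRest`). [folklore] -/
theorem weak_transport_ineq_of_selfSimilar {ρ : ℝ} (hρ : 0 < ρ) (hρh : ρ ≤ 1 / 2)
    {u : ℝ → EuclideanSpace ℝ (Fin 3) → EuclideanSpace ℝ (Fin 3)} {p : ℝ → EuclideanSpace ℝ (Fin 3) → ℝ}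
    {H : ℝ → EuclideanSpace ℝ (Fin 3) → EuclideanSpace ℝ (Fin 3) →L[ℝ] EuclideanSpace ℝ (Fin 3)} {c : ℝ≥0}
    (hsw : IsSuitableWeakSolutionOn (slab (EuclideanSpace ℝ (Fin 3)) (Iio 0) isOpen_Iio) 0 0 u p)
    (hH : HasWeakSpatialGradientOn (slab (EuclideanSpace ℝ (Fin 3)) (Iio 0) isOpen_Iio) u H)
    (hgauge : ∀ a : ℝ, 0 < a →
      ENNReal.ofReal (a ^ (2 * ρ)) * cknA a (0 : ℝ × EuclideanSpace ℝ (Fin 3)) u +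
          ENNReal.ofReal (a ^ ρ) * cknE a (0 : ℝ × EuclideanSpace ℝ (Fin 3)) H +
        ENNReal.ofReal (a ^ (2 * ρ)) * cknD a (0 : ℝ × EuclideanSpace ℝ (Fin 3)) p ≤ (c : ℝ≥0∞))
    {V : EuclideanSpace ℝ (Fin 3) → EuclideanSpace ℝ (Fin 3)} {P : EuclideanSpace ℝ (Fin 3) → ℝ}
    (hu : ∀ τ : ℝ, τ < 0 → u τ = selfSimilarCollapse (1 / (2 + ρ)) 0 V τ)
    (hp : ∀ τ : ℝ, τ < 0 → p τ = selfSimilarCollapsePressure (1 / (2 + ρ)) 0 P τ)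
    {θ : EuclideanSpace ℝ (Fin 3) → ℝ} (hθ : IsTestFunctionOn (⊤ : Opens (EuclideanSpace ℝ (Fin 3))) θ)
    (hθ0 : ∀ y, 0 ≤ θ y) :
    0 ≤ (∫ y, selfSimilarBernoulli (1 / (2 + ρ)) 0 V P y *
        ⟪selfSimilarTransport (1 / (2 + ρ)) 0 V y, gradient θ y⟫) +
      3 * (1 / (2 + ρ)) * ∫ y, θ y * selfSimilarBernoulli (1 / (2 + ρ)) 0 V P y := by
  rw [weak_transport_law_of_selfSimilar hρ hρh hsw hH hgauge hu hp hθ]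
  have h : 0 ≤ ∫ y, θ y * ‖selfSimilarTransport (1 / (2 + ρ)) 0 V y‖ ^ 2 :=
    integral_nonneg fun y => mul_nonneg (hθ0 y) (by positivity)
  have hγ : 2 * (1 / (2 + ρ)) ≤ 1 := by
    rw [mul_one_div, div_le_one (by linarith)]
    linarith
  nlinarith

end Member

end WeakBernoulli

end Summit.NavierStokesRegularity.NavierStokesRegularity.Theorems.PowerGaugeEulerLiouville
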